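import Literature.Probability.LatticeModels.ScaleFrame
import Literature.Probability.Percolation.BlockExplorationBasic
import Literature.Probability.Percolation.Crossings
import HarnessLib

/-!
# Kesten's kernel on a scale frame: the deterministic path lemmas (proved)

Topic `Literature/Probability/LatticeModels` (trunk `StatMech`, family `crit-ising`). Path surgery
behind the cross-ratio bound of the chain kernel of Kesten's ratio-limit scheme (H. Kesten, PTRF 73
(1986), §2, Lemma (23)) in the planarity-free form of D. Basu, A. Sapozhnikov (ECP 22 (2017), §2,
eq. (2.9)), for the exploration data of `BlockExploration*.lean` (explored set `𝒞 = explSet In Blk ω`,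
rim `𝒟 = explRim In Blk ω`, datum event `explEvent In Blk X Y`) with the rim WIRED OFF THE INSIDE:
any two rim vertices hang, through open edges, off two vertices of `X ∖ In` joined by an open path
inside `X ∖ In`.

* `explEventOff_iff_of_agree` — the off-wired datum event only looks at the pairs touching `X`;
* `openCrossing_iff_of_explEventOff` — (E7, regional, off) on the off-wired datum event of `(X, Y)`,
  an open crossing inside a region `Z` from `A ⊆ Z ∖ X` to `B ⊆ X ∩ Z` splits as a crossing inside
  `Z ∖ X` from `A` to the rim `Y` (up to the FIRST entrance into `X`) and an open edge from a rim
  vertex into `X` followed by a crossing inside `X ∩ Z` to `B` (after the LAST vertex outside `X`);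
  conversely the pieces are glued through the off-wired rim;
* `explRimWiredOff_of_separating` — (E5, off) a vertex set `P ⊆ Blk ∖ In`, pairwise open-connected
  inside `Blk ∖ In` and met by every walk between `In` and the outside of `In ∪ Blk`, wires the rim
  off the inside: follow the attaching edge of a rim vertex and the exploring path up to its FIRST
  visit to `P`; a vertex of `In` before that visit would give a walk from `In` to the rim vertex
  missing `P`;
* `ScaleFrame.explRimWiredOff_of_sepEvent_out` / `ScaleFrame.explRimWiredOff_of_sepEvent_in` — on a
  scale frame an open separator of the annulus `(b, b')` wires off the inside the rim of the
  exploration of `annSet b b'` from the OUTSIDE `outSet b b'`, and an open separator of a sub-annulus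
  `(s, s')`, `a₀ ≤ s < s' ≤ top`, wires off the inside the rim of the exploration of `annSet a₀ top`
  from the INSIDE `inSet a₀`.

Everything is proved; no definitions, no named facts.

## References

* [Kesten1986] H. Kesten, The incipient infinite cluster in two-dimensional percolation, *Probab.
  Theory Related Fields* 73 (1986) 369–394, §2, Lemma (23).
* [BasuSapozhnikov2017ECP] D. Basu, A. Sapozhnikov, Kesten's incipient infinite cluster and
  quasi-multiplicativity of crossing probabilities, *Electron. Commun. Probab.* 22 (2017) no. 26,
  §2, eq. (2.3) and eq. (2.9).
-/

open Finset SimpleGraph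
open Literature.Probability.Percolation (BondConfig openConnIn openCrossing openGraph openGraph_adj
  PathIn explSet explRim explEvent mem_explRim_iff mem_explSet_iff_exists explRim_disjoint
  mem_explSet_of_open_edge mem_of_mem_explEvent_of_open_edge mem_explEvent_iff
  mem_explEvent_iff_of_agree_on_touching openConnIn_mono)

namespace Literature.Probability.LatticeModels

variable {V : Type*}

/-! ### The off-wired datum event is read on the pairs touching the explored set -/

/-- **The off-wired datum event only looks at the pairs touching the explored set**: two
configurations agreeing on every pair with a vertex in `X` lie in
`explEvent In Blk X Y ∩ {rim wired through X ∖ In}` together (the datum event by (E2); the wiring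
clause reads attaching edges and open paths issuing from `X ∖ In ⊆ X`).
[cite: BasuSapozhnikov2017ECP, §2, paragraph after eq. (2.3)] -/
theorem explEventOff_iff_of_agree {In Blk X Y : Set V} {ω₁ ω₂ : BondConfig V}
    (hag : ∀ e : Sym2 V, (∃ v ∈ X, v ∈ e) → (e ∈ ω₁ ↔ e ∈ ω₂)) :
    ω₁ ∈ explEvent In Blk X Y ∩
        {ω : BondConfig V | ∀ r ∈ Y, ∀ r₂ ∈ Y, ∃ v ∈ X \ In, ∃ v' ∈ X \ In,
          s(v, r) ∈ ω ∧ s(v', r₂) ∈ ω ∧ ω ∈ openConnIn (X \ In) v v'} ↔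
      ω₂ ∈ explEvent In Blk X Y ∩
        {ω : BondConfig V | ∀ r ∈ Y, ∀ r₂ ∈ Y, ∃ v ∈ X \ In, ∃ v' ∈ X \ In,
          s(v, r) ∈ ω ∧ s(v', r₂) ∈ ω ∧ ω ∈ openConnIn (X \ In) v v'} := by
  have hwire : ∀ {ωa ωb : BondConfig V},
      (∀ e : Sym2 V, (∃ v ∈ X, v ∈ e) → (e ∈ ωa ↔ e ∈ ωb)) →
      (∀ r ∈ Y, ∀ r₂ ∈ Y, ∃ v ∈ X \ In, ∃ v' ∈ X \ In,
        s(v, r) ∈ ωa ∧ s(v', r₂) ∈ ωa ∧ ωa ∈ openConnIn (X \ In) v v') →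
      ∀ r ∈ Y, ∀ r₂ ∈ Y, ∃ v ∈ X \ In, ∃ v' ∈ X \ In,
        s(v, r) ∈ ωb ∧ s(v', r₂) ∈ ωb ∧ ωb ∈ openConnIn (X \ In) v v' := by
    intro ωa ωb h hW r hr r₂ hr₂
    obtain ⟨v, hv, v', hv', h1, h2, h3⟩ := hW r hr r₂ hr₂
    exact ⟨v, hv, v', hv', (h _ ⟨v, hv.1, Sym2.mem_mk_left v r⟩).1 h1,
      (h _ ⟨v', hv'.1, Sym2.mem_mk_left v' r₂⟩).1 h2,
      Percolation.BlockExploration.openConnIn_of_agree h3 fun a ha b _ hab =>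
        (h _ ⟨a, ha.1, Sym2.mem_mk_left a b⟩).1 hab⟩
  rw [Set.mem_inter_iff, Set.mem_inter_iff, mem_explEvent_iff_of_agree_on_touching hag]
  exact and_congr_right fun _ => ⟨hwire hag, hwire fun e he => (hag e he).symm⟩

/-! ### (E7, regional, off) Splitting a crossing at an off-wired datum -/

/-- **(E7, regional, off the inside).** On the datum event `explEvent In Blk X Y` with the rim wired
through `X ∖ In`, for a region `Z ⊇ Y ∪ (X ∖ In)` and targets `A ⊆ Z ∖ X`, `B ⊆ X ∩ Z`: there is an
open crossing inside `Z` from `A` to `B` iff (i) there is an open crossing inside `Z ∖ X` from `A` to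
the rim `Y` (the piece before the FIRST entrance into `X`: the entrance edge issues from a rim
vertex) and (ii) some rim vertex `y` carries an open edge to a vertex `v ∈ X` joined to `B` inside
`X ∩ Z` (the piece after the LAST vertex outside `X`). Conversely the two pieces are glued inside `Z`
through the wiring of the rim off the inside. [cite: BasuSapozhnikov2017ECP, §2 eq. (2.9)] -/
theorem openCrossing_iff_of_explEventOff {In Blk X Y Z A B : Set V} {ω : BondConfig V}
    (hω : ω ∈ explEvent In Blk X Y)
    (hW : ∀ r ∈ Y, ∀ r₂ ∈ Y, ∃ v ∈ X \ In, ∃ v' ∈ X \ In,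
      s(v, r) ∈ ω ∧ s(v', r₂) ∈ ω ∧ ω ∈ openConnIn (X \ In) v v')
    (hYZ : Y ⊆ Z) (hXZ : X \ In ⊆ Z) (hA : A ⊆ Z \ X) (hB : B ⊆ X ∩ Z) :
    ω ∈ openCrossing Z A B ↔
      ω ∈ openCrossing (Z \ X) A Y ∧
        ∃ y ∈ Y, ∃ v ∈ X, s(v, y) ∈ ω ∧ ω ∈ openCrossing (X ∩ Z) {v} B := by
  -- `X` is the explored set and `Y` the rim: they are disjoint
  have hXY : ∀ {a b : V}, a ∈ X → b ∈ Y → a ≠ b := by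
    obtain ⟨h1, h2⟩ := mem_explEvent_iff.1 hω
    rintro a b ha hb rfl
    rw [← h1] at ha
    rw [← h2] at hb
    exact (mem_explRim_iff.1 hb).1 ha
  constructor
  · rintro ⟨a, ha, bb, hbb, habb⟩
    rw [Percolation.mem_openConnIn_iff_pathIn] at habb
    have haX : a ∈ Xᶜ := (hA ha).2
    have hbbX : bb ∉ Xᶜ := not_not.2 (hB hbb).1
    constructor
    · -- the first entrance into `X`
      obtain ⟨a₁, b₁, ha₁, hb₁, -, hab₁, hpath⟩ := habb.exit haX hbbX
      have hedge : s(b₁, a₁) ∈ ω := by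
        rw [Sym2.eq_swap]
        exact ((openGraph_adj ω a₁ b₁).1 hab₁).1
      refine ⟨a, ha, a₁, mem_of_mem_explEvent_of_open_edge hω (not_not.1 hb₁) hedge ha₁, ?_⟩
      rw [Percolation.mem_openConnIn_iff_pathIn]
      exact hpath.mono fun v hv => ⟨hv.2, hv.1⟩
    · -- the last vertex outside `X`
      obtain ⟨a₂, b₂, ha₂, -, hb₂, hab₂, hpath⟩ := habb.last_exit haX hbbX
      have hb₂X : b₂ ∈ X := not_not.1 hb₂
      have hedge : s(b₂, a₂) ∈ ω := by
        rw [Sym2.eq_swap]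
        exact ((openGraph_adj ω a₂ b₂).1 hab₂).1
      refine ⟨a₂, mem_of_mem_explEvent_of_open_edge hω hb₂X hedge ha₂, b₂, hb₂X, hedge, b₂, rfl,
        bb, hbb, ?_⟩
      rw [Percolation.mem_openConnIn_iff_pathIn]
      exact hpath.mono fun v hv => ⟨not_not.1 hv.2, hv.1⟩
  · rintro ⟨⟨a, ha, y, hy, hay⟩, y', hy', v, hv, hvy', v₀, hv₀, bb, hbb, hvbb⟩
    rw [Set.mem_singleton_iff] at hv₀
    subst hv₀
    obtain ⟨v₁, hv₁, v₂, hv₂, hv₁y, hv₂y', hv₁v₂⟩ := hW y hy y' hy'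
    have mono : ∀ {S : Set V} {c d : V}, S ⊆ Z → ω ∈ openConnIn S c d → ω ∈ openConnIn Z c d :=
      fun hS h => openConnIn_mono hS _ _ h
    have hv₀Z : v₀ ∈ Z := hvbb.1.2
    refine ⟨a, ha, bb, hbb, ?_⟩
    -- `a ~ y — v₁ ~ v₂ — y' — v₀ ~ bb`, everything inside `Z`
    refine Percolation.PlanarDuality.openConnIn_trans (mono Set.sdiff_subset hay) ?_
    refine Percolation.PlanarDuality.openConnIn_trans
      (Percolation.openConnIn_of_adj (hYZ hy) (hXZ hv₁) (by rw [Sym2.eq_swap]; exact hv₁y)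
        (hXY hv₁.1 hy).symm) ?_
    refine Percolation.PlanarDuality.openConnIn_trans (mono hXZ hv₁v₂) ?_
    refine Percolation.PlanarDuality.openConnIn_trans
      (Percolation.openConnIn_of_adj (hXZ hv₂) (hYZ hy') hv₂y' (hXY hv₂.1 hy')) ?_
    exact Percolation.PlanarDuality.openConnIn_trans
      (Percolation.openConnIn_of_adj (hYZ hy') hv₀Z (by rw [Sym2.eq_swap]; exact hvy')
        (hXY hv hy').symm) (mono Set.inter_subset_right hvbb)

/-! ### (E5, off) A separating open-connected set wires the rim off the inside -/

/-- A chain of open edges inside `S` is a walk inside `S` of any graph containing the open pairs.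
[folklore] -/
theorem exists_walk_of_openPathIn {Gr : SimpleGraph V} {ω : BondConfig V}
    (hω : ∀ x y : V, s(x, y) ∈ ω → x ≠ y → Gr.Adj x y) {S : Set V} {u v : V}
    (h : PathIn (openGraph ω) S u v) : ∃ w : Gr.Walk u v, ∀ z ∈ w.support, z ∈ S := by
  obtain ⟨hu, h⟩ := h
  induction h with
  | refl =>
    refine ⟨Walk.nil, fun z hz => ?_⟩
    rw [Walk.support_nil, List.mem_singleton] at hz
    exact hz ▸ hu
  | @tail b c _ hbc ih =>
    obtain ⟨w, hw⟩ := ih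
    have h' := (openGraph_adj ω b c).1 hbc.1
    refine ⟨w.concat (hω b c h'.1 h'.2), fun z hz => ?_⟩
    rw [Walk.support_concat, List.mem_append, List.mem_singleton] at hz
    rcases hz with hz | rfl
    · exact hw z hz
    · exact hbc.2

/-- **(E5, off the inside) A separating open-connected set wires the rim off the inside.** Let the
open pairs of `ω` be edges of `Gr`, let `P ⊆ Blk` miss `In`, be pairwise open-connected inside
`Blk ∖ In`, and meet every `Gr`-walk from a vertex of `In` to a vertex outside `In ∪ Blk`. Then any
two rim vertices of the exploration of `Blk` from `In` hang, through open edges, off two vertices of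
`𝒞 ∖ In` joined by an open path inside `𝒞 ∖ In` (`𝒞 = explSet In Blk ω`): follow the attaching
edge `r — x` and the exploring path from `x` up to its FIRST visit `z` to `P`; a vertex of `In` on the
way (or `x ∈ In`, or no visit at all) would give a walk from `In` to `r` missing `P`; the piece
`x → z` runs inside `𝒞 ∖ In`, and two such `z` are joined inside `Blk ∖ In`, hence inside `𝒞 ∖ In`.
[cite: BasuSapozhnikov2017ECP, §2, paragraph after eq. (2.3)] -/
theorem explRimWiredOff_of_separating {Gr : SimpleGraph V} {ω : BondConfig V}
    (hω : ∀ x y : V, s(x, y) ∈ ω → x ≠ y → Gr.Adj x y) {In Blk : Set V} (P : Set V)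
    (hP : P ⊆ Blk) (hPIn : ∀ z ∈ P, z ∉ In)
    (hconn : ∀ z₁ ∈ P, ∀ z₂ ∈ P, ω ∈ openConnIn (Blk \ In) z₁ z₂)
    (hsep : ∀ u r : V, u ∈ In → r ∉ In ∪ Blk → ∀ w : Gr.Walk u r, ∃ z ∈ w.support, z ∈ P) :
    ∀ r ∈ explRim In Blk ω, ∀ r₂ ∈ explRim In Blk ω,
      ∃ v ∈ explSet In Blk ω \ In, ∃ v' ∈ explSet In Blk ω \ In,
        s(v, r) ∈ ω ∧ s(v', r₂) ∈ ω ∧ ω ∈ openConnIn (explSet In Blk ω \ In) v v' := by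
  -- an open chain inside `S ⊆ In ∪ Blk` from an explored vertex stays explored
  have hexpl : ∀ {S : Set V} {x w : V}, S ⊆ In ∪ Blk → x ∈ explSet In Blk ω →
      PathIn (openGraph ω) S x w → PathIn (openGraph ω) (explSet In Blk ω ∩ S) x w := by
    intro S x w hS hx h
    obtain ⟨hxS, h⟩ := h
    refine ⟨⟨hx, hxS⟩, ?_⟩
    induction h with
    | refl => exact Relation.ReflTransGen.refl
    | @tail b c _ hbc ih =>
      have hb : b ∈ explSet In Blk ω :=
        (show PathIn (openGraph ω) (explSet In Blk ω ∩ S) x b from ⟨⟨hx, hxS⟩, ih⟩).right_mem.1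
      exact ih.tail ⟨hbc.1, mem_explSet_of_open_edge hb ((openGraph_adj ω b c).1 hbc.1).1
        (hS hbc.2), hbc.2⟩
  -- an open chain missing `P` from `x` to a vertex `t ∈ In`, with `x` attached to a vertex `r`
  -- outside `In ∪ Blk`, contradicts the separation
  have hcontra : ∀ {S : Set V} {x t r : V}, (∀ z ∈ S, z ∉ P) → PathIn (openGraph ω) S x t →
      t ∈ In → s(x, r) ∈ ω → x ≠ r → r ∉ In ∪ Blk → False := by
    intro S x t r hS hxt ht hxr hne hr
    obtain ⟨w, hw⟩ := exists_walk_of_openPathIn hω hxt.symm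
    obtain ⟨z, hz, hzP⟩ := hsep t r ht hr (w.concat (hω x r hxr hne))
    rw [Walk.support_concat, List.mem_append, List.mem_singleton] at hz
    rcases hz with hz | rfl
    · exact hS z (hw z hz) hzP
    · exact hr (Or.inr (hP hzP))
  -- each rim vertex hangs off an explored vertex joined inside `𝒞 ∖ In` to a vertex of `P`
  have key : ∀ r ∈ explRim In Blk ω, ∃ x : V, s(x, r) ∈ ω ∧
      ∃ z ∈ P, PathIn (openGraph ω) (explSet In Blk ω \ In) x z := by
    intro r hr
    obtain ⟨hrU, x, hx, hxr⟩ := mem_explRim_iff.1 hr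
    have hrIB : r ∉ In ∪ Blk := explRim_disjoint hr
    have hne : x ≠ r := fun h => hrU (h ▸ hx)
    obtain ⟨-, u, hu, hux⟩ := mem_explSet_iff_exists.1 hx
    rw [Percolation.mem_openConnIn_iff_pathIn] at hux
    refine ⟨x, hxr, ?_⟩
    by_cases hxP : x ∈ P
    · exact ⟨x, hxP, PathIn.refl ⟨hx, hPIn x hxP⟩⟩
    have hxIn : x ∉ In := fun hxIn =>
      hcontra (S := {x}) (fun z hz => (Set.mem_singleton_iff.1 hz).symm ▸ hxP)
        (PathIn.refl (Set.mem_singleton x)) hxIn hxr hne hrIB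
    -- the first visit to `P` along the reversed exploring path `x → u`
    rcases hux.symm.exit_or (R := Pᶜ) hxP with h | ⟨a, b, -, hbP, hbIB, hab, hxa⟩
    · exact (hcontra (fun z hz => hz.1) h hu hxr hne hrIB).elim
    have hbP' : b ∈ P := not_not.1 hbP
    -- the piece `x → a` avoids `In`
    rcases hxa.exit_or (R := Inᶜ) hxIn with h' | ⟨a', b', -, hb'In, -, ha'b', hxa'⟩
    · refine ⟨b, hbP', ?_⟩
      have hsub : Inᶜ ∩ (Pᶜ ∩ (In ∪ Blk)) ⊆ (In ∪ Blk) ∩ Inᶜ := fun v hv => ⟨hv.2.2, hv.1⟩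
      have h1 : PathIn (openGraph ω) ((In ∪ Blk) ∩ Inᶜ) x b :=
        (h'.mono hsub).tail hab ⟨hbIB, hPIn b hbP'⟩
      exact (hexpl Set.inter_subset_left hx h1).mono fun v hv => ⟨hv.1, hv.2.2⟩
    · have hb'In' : b' ∈ In := not_not.1 hb'In
      refine (hcontra (S := insert b' (Inᶜ ∩ (Pᶜ ∩ (In ∪ Blk)))) ?_
        ((hxa'.mono (Set.subset_insert _ _)).tail ha'b' (Set.mem_insert _ _)) hb'In' hxr hne
        hrIB).elim
      rintro z (rfl | hz) hzP
      · exact hPIn z hzP hb'In'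
      · exact hz.2.1 hzP
  intro r hr r₂ hr₂
  obtain ⟨x, hxr, z, hzP, hxz⟩ := key r hr
  obtain ⟨x₂, hx₂r₂, z₂, hz₂P, hx₂z₂⟩ := key r₂ hr₂
  have hzz₂ : PathIn (openGraph ω) (explSet In Blk ω \ In) z z₂ := by
    have h := hconn z hzP z₂ hz₂P
    rw [Percolation.mem_openConnIn_iff_pathIn] at h
    exact (hexpl (fun v hv => Or.inr hv.1) hxz.right_mem.1 h).mono fun v hv => ⟨hv.1, hv.2.2⟩
  refine ⟨x, hxz.left_mem, x₂, hx₂z₂.left_mem, hxr, hx₂r₂, ?_⟩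
  rw [Percolation.mem_openConnIn_iff_pathIn]
  exact hxz.trans (hzz₂.trans hx₂z₂.symm)

/-! ### On a scale frame: open separators wire the rim off the inside -/

namespace ScaleFrame

variable [Fintype V] [DecidableEq V] (F : ScaleFrame V)

/-- **An open separator of `(b, b')` wires off the inside the rim of the exploration of the annulus
from OUTSIDE** (inner set `outSet b b'`, block `annSet b b'`; the rim lies in `inSet b`): every walk
from the rim side `inSet b` to `outSet b b'` meets the separator, which is pairwise open-connected
inside the annulus. [cite: Kesten1986, §2 Lemma (23)] -/
theorem explRimWiredOff_of_sepEvent_out {b b' : ℝ} {ω : BondConfig V}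
    (hωE : ω ⊆ (↑F.E : Set (Sym2 V))) (hsep : ω ∈ F.sepEvent b b') :
    ∀ r ∈ explRim (F.outSet b b') (F.annSet b b') ω,
      ∀ r₂ ∈ explRim (F.outSet b b') (F.annSet b b') ω,
        ∃ v ∈ explSet (F.outSet b b') (F.annSet b b') ω \ F.outSet b b',
          ∃ v' ∈ explSet (F.outSet b b') (F.annSet b b') ω \ F.outSet b b',
            s(v, r) ∈ ω ∧ s(v', r₂) ∈ ω ∧
              ω ∈ openConnIn (explSet (F.outSet b b') (F.annSet b b') ω \ F.outSet b b') v v' := by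
  obtain ⟨P, hPsub, hconn, hPsep⟩ := hsep
  have hω : ∀ x y : V, s(x, y) ∈ ω → x ≠ y → F.graph.Adj x y :=
    fun x y h hne => (fromEdgeSet_adj _).2 ⟨hωE h, hne⟩
  have hAO : ∀ z ∈ F.annSet b b', z ∉ F.outSet b b' := fun z hz hzO => hzO (Or.inr hz)
  refine explRimWiredOff_of_separating hω P hPsub (fun z hz => hAO z (hPsub hz))
    (fun z₁ hz₁ z₂ hz₂ => openConnIn_mono
      (show F.annSet b b' ⊆ F.annSet b b' \ F.outSet b b' from fun v hv => ⟨hv, hAO v hv⟩) _ _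
      (hconn z₁ hz₁ z₂ hz₂))
    fun u r hu hr w => ?_
  have hr' : r ∈ F.inSet b := by
    obtain ⟨hr₁, hr₂⟩ := not_or.1 hr
    exact (not_not.1 (mt F.mem_outSet.2 hr₁)).resolve_right hr₂
  obtain ⟨z, hz, hzP⟩ := hPsep r u hr' hu w.reverse
  rw [Walk.support_reverse, List.mem_reverse] at hz
  exact ⟨z, hz, hzP⟩

/-- **An open separator of a sub-annulus `(s, s')`, `a₀ ≤ s < s' ≤ top`, wires off the inside the rim
of the exploration of `annSet a₀ top` from INSIDE `inSet a₀`**: the rim lies outside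
`inSet a₀ ∪ annSet a₀ top ⊆ outSet s s'`, the inside in `inSet s`, so every walk between them meets the
separator, which is pairwise open-connected inside `annSet s s' ⊆ annSet a₀ top ∖ inSet a₀`.
[cite: Kesten1986, §2 Lemma (23)] -/
theorem explRimWiredOff_of_sepEvent_in {a₀ top s s' : ℝ} {ω : BondConfig V}
    (hωE : ω ⊆ (↑F.E : Set (Sym2 V))) (ha : a₀ ≤ s) (hss : s < s') (hs' : s' ≤ top)
    (hsep : ω ∈ F.sepEvent s s') :
    ∀ r ∈ explRim (F.inSet a₀) (F.annSet a₀ top) ω,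
      ∀ r₂ ∈ explRim (F.inSet a₀) (F.annSet a₀ top) ω,
        ∃ v ∈ explSet (F.inSet a₀) (F.annSet a₀ top) ω \ F.inSet a₀,
          ∃ v' ∈ explSet (F.inSet a₀) (F.annSet a₀ top) ω \ F.inSet a₀,
            s(v, r) ∈ ω ∧ s(v', r₂) ∈ ω ∧
              ω ∈ openConnIn (explSet (F.inSet a₀) (F.annSet a₀ top) ω \ F.inSet a₀) v v' := by
  obtain ⟨P, hPsub, hconn, hPsep⟩ := hsep
  have hω : ∀ x y : V, s(x, y) ∈ ω → x ≠ y → F.graph.Adj x y :=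
    fun x y h hne => (fromEdgeSet_adj _).2 ⟨hωE h, hne⟩
  have hAB : F.annSet s s' ⊆ F.annSet a₀ top \ F.inSet a₀ := fun z ⟨hg, h1, h2⟩ =>
    ⟨⟨hg, ha.trans_lt h1, h2.trans_le hs'⟩, fun ⟨_, h3⟩ => absurd (h3.trans ha) (not_le.2 h1)⟩
  refine explRimWiredOff_of_separating hω P (fun z hz => (hAB (hPsub hz)).1)
    (fun z hz => (hAB (hPsub hz)).2)
    (fun z₁ hz₁ z₂ hz₂ => openConnIn_mono hAB _ _ (hconn z₁ hz₁ z₂ hz₂)) fun u r hu hr w => ?_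
  have hu' : u ∈ F.inSet s := ⟨hu.1, hu.2.trans ha⟩
  have hr' : r ∈ F.outSet s s' := by
    rw [F.mem_outSet]
    rintro (⟨hg, h1⟩ | ⟨hg, h1, h2⟩)
    · by_cases h0 : F.rad r ≤ a₀
      · exact hr (Or.inl ⟨hg, h0⟩)
      · exact hr (Or.inr ⟨hg, not_le.1 h0, (h1.trans_lt hss).trans_le hs'⟩)
    · exact hr (Or.inr ⟨hg, ha.trans_lt h1, h2.trans_le hs'⟩)
  exact hPsep u r hu' hr' w

end ScaleFrame

end Literature.Probability.LatticeModels
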